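import Literature.Computability.QuantumComplexity.IQPForrelation
import Literature.Computability.QuantumComplexity.CubicForrelation
import HarnessLib

/-!
# Derivative Walsh tables and the square of the 2-fold forrelation

Topic `Literature/Computability/QuantumComplexity` (family `quantum-advantage`; written by the refuter
seat `refuter-cdisprove-stmt-QuantumAdvantage-2203-0`, 2026-08-15, as the mathematical core of the
dequantization of CUBIC 2-fold Forrelation — route `QuantumAdvantage/CubicForrelation`, items
stmt-QuantumAdvantage-2200/2203/2204). EVERYTHING here is a theorem (no named facts).

For real `f g : {0,1}ⁿ → ℝ` put `S(f,g) = ∑_{x,y} f(x) (-1)^{x·y} g(y)`, so that the tree's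
`forrelation f g` (Boolean data read through `signOf`) and `BuzetChailloux.phi` are `S / 2^{3n/2}`
(`phi_eq_fsum`, `phi_signOf`). The **derivative Walsh table** of `f` is
`T_f(h,u) = ∑_x f(x) f(x ⊕ h) (-1)^{u·x}` (`dwt f h u`): for `f = (-1)^a` it is the Walsh coefficient
`W_{D_h a}(u)` of the derivative `D_h a(x) = a(x) + a(x ⊕ h)`, which is QUADRATIC when `a` is cubic —
hence an exact, polynomial-time quadratic Gauss sum whose rows are plateaued.

## Contents (all proved)

* `sum_dwt_mul_dwt` : `∑_{h,u} T_f(h,u) · T_g(u,h) = S(f,g)²` for ALL real `f, g` (reindex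
  `h = x ⊕ x'`, `u = y ⊕ y'`; the two characters `(-1)^{x·y}` cancel — no orthogonality needed);
  `two_pow_mul_forrelation_sq` : `2^{3n} · forrelation f g ^ 2 = ∑_{h,u} T_f(h,u) T_g(u,h)`.
* `sum_dwt_sq` (Parseval per derivative), `sum_dwt_sq_of_sq` : `∑_u T_f(h,u)² = 4ⁿ` for every `h`
  when `f² = 1`, `sum_sum_dwt_sq_of_sq` : `‖T_f‖² = 8ⁿ`.
* `sum_sq_sub_eq` : `∑_{h,u} (T_f(h,u) - T_g(u,h))² = 2·8ⁿ - 2·S(f,g)²` for `±1`-valued `f, g`; hence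
  `dwt_transpose_of_fsum_sq` / `dwt_transpose_of_forrelation_sq_eq_one` : `Φ(f,g)² = 1 ⇒ T_g = T_fᵀ`
  entrywise (the derivative spectra of a bent function and its dual are transposes — Carlet's
  property of duals — here with the converse in robust form), and for white-box instances
  `tables_transposed_of_value_eq_one` (`I.k = 2`, `I.value = 1`).
* `dwt_neg`, `signOf_not`, `forrelation_not_right`, `dwt_signOf_not` : the tables are blind to
  `g ↦ ¬g`, which flips the sign of `Φ`.

## Why it matters (prose; the complexity-class statement is NOT formalised here)

Sampling `(h,u)` with probability `T_f(h,u)²/8ⁿ` — `h` uniform (row mass `4ⁿ`), then `u` uniform on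
the support of row `h`, which for cubic `a` is an explicit affine subspace on which `|T_f(h,u)|` is
constant — and averaging `Y = 8ⁿ · T_g(u,h)/T_f(h,u)` gives an unbiased estimator of `Φ²` with
per-sample variance `≤ 1` (`E[Y²] = 8ⁿ‖T_g‖² = 64ⁿ`), every sample costing two quadratic Gauss sums
(`O(n³)` bit operations). So for CUBIC phase polynomials the Aaronson–Ambainis promise `Φ ≥ 3/5` vs
`|Φ| ≤ 1/100` at `k = 2` is decidable in classical randomized polynomial time, and the exact slice
`Φ = 1` vs `|Φ| ≤ 1/100` even with one-sided error (all samples match on yes-instances; on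
no-instances a sample mismatches with probability `> 0.35` by Cauchy–Schwarz). The trick buys exactly
one Hadamard layer: for 3-fold Forrelation the analogous estimator has relative deviation `2^{n/2}`
(consistent with Aaronson–Ambainis Thm 25: `k = poly(n)` cubic instances are `PromiseBQP`-complete).
The SIGNED slice `Φ = 1` vs `Φ = -1` is invisible to the tables (`dwt_signOf_not`).

NOT here: the `PromiseBPP'`-membership statements themselves (they need a `TM2` witness for
`Classes.P`); the plateau/support structure of quadratic Walsh spectra (Dickson), used only by the
sampler; the Cauchy–Schwarz soundness bound as a Lean statement.

## References

* [AaronsonAmbainis2018] S. Aaronson, A. Ambainis, Forrelation, SIAM J. Comput. 47 (2018), §1.1.1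
  (`Φ`), §6 Thm 25–26 (cubic instances, `k = poly`).
* [ODonnell2014] R. O'Donnell, Analysis of Boolean Functions (2014), §1.4 (characters, Parseval).
* C. Carlet, Boolean Functions for Cryptography and Coding Theory, CUP 2021, §6.1 (duals of bent
  functions and their derivatives) — orientation only; the statements below are proved from scratch.
* E. Tang, A quantum-inspired classical algorithm for recommendation systems, STOC 2019
  (length-squared sampling) — orientation for the estimator.
-/

noncomputable section

namespace Literature.Computability.QuantumComplexity

namespace DerivativeWalsh

open Finset
open Literature.Computability.QuantumComplexity.BuzetChailloux
open Literature.Computability.QuantumComplexity.Simon (twist_mul_self twist_xor_left sum_twist)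

variable {n : ℕ}

/-! ### The identity `∑_{h,u} T_f(h,u) T_g(u,h) = S(f,g)²` -/

/-- The derivative Walsh table `T_f(h,u) = ∑_x f(x) f(x ⊕ h) (-1)^{u·x}` (for `f = (-1)^a` with `a`
cubic this is the Walsh coefficient `W_{D_h a}(u)` of the QUADRATIC derivative `D_h a`). [folklore] -/
def dwt (f : (Fin n → Bool) → ℝ) (h u : Fin n → Bool) : ℝ :=
  ∑ x, f x * f (bxor x h) * twist u x

/-- The unnormalised Walsh transform `W_f(y) = ∑_x f(x) (-1)^{x·y}`. [folklore] -/
def W (f : (Fin n → Bool) → ℝ) (y : Fin n → Bool) : ℝ :=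
  ∑ x, f x * twist x y

/-- The unnormalised forrelation sum `S(f,g) = ∑_{x,y} f(x) (-1)^{x·y} g(y)` (`Φ = S / 2^{3n/2}`).
[cite: AaronsonAmbainis2018, §1.1.1] -/
def fsum (f g : (Fin n → Bool) → ℝ) : ℝ :=
  ∑ x, ∑ y, f x * twist x y * g y

/-- `phi f g = 2^{-3n/2} · S(f,g)` (definitional). [cite: AaronsonAmbainis2018, §1.1.1] -/
theorem phi_eq_fsum (f g : (Fin n → Bool) → ℝ) :
    phi f g = (Real.sqrt ((2 : ℝ) ^ (3 * n)))⁻¹ * fsum f g := rfl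

/-- `S(f,g) = ∑_x f(x) W_g(x)`. [folklore] -/
theorem fsum_eq_sum_mul_W (f g : (Fin n → Bool) → ℝ) : fsum f g = ∑ x, f x * W g x := by
  unfold fsum W
  refine sum_congr rfl fun x _ => ?_
  rw [mul_sum]
  refine sum_congr rfl fun y _ => ?_
  rw [twist_comm y x]
  ring

/-- `S(f,g) = ∑_y g(y) W_f(y)`. [folklore] -/
theorem fsum_eq_sum_mul_W' (f g : (Fin n → Bool) → ℝ) : fsum f g = ∑ y, g y * W f y := by
  unfold fsum W
  rw [sum_comm]
  refine sum_congr rfl fun y _ => ?_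
  rw [mul_sum]
  refine sum_congr rfl fun x _ => ?_
  ring

/-- Translated character sum: `∑_h f(x ⊕ h) (-1)^{h·y} = (-1)^{x·y} W_f(y)` (reindex `h = x ⊕ x'`).
[folklore] -/
theorem sum_shift_twist (f : (Fin n → Bool) → ℝ) (x y : Fin n → Bool) :
    ∑ h, f (bxor x h) * twist h y = twist x y * W f y := by
  rw [← Equiv.sum_comp (bxorPerm x) (fun h => f (bxor x h) * twist h y), W, mul_sum]
  refine sum_congr rfl fun x' _ => ?_
  rw [bxorPerm_apply, bxor_bxor_cancel_left, show bxor x x' = fun i => x i ^^ x' i from rfl,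
    twist_xor_left]
  ring

/-- `∑_u (-1)^{u·x} T_g(u,h) = W_g(x) · ∑_y g(y) (-1)^{y·x} (-1)^{h·y}`. [folklore] -/
theorem sum_twist_mul_dwt (g : (Fin n → Bool) → ℝ) (x h : Fin n → Bool) :
    ∑ u, twist u x * dwt g u h = W g x * ∑ y, g y * twist y x * twist h y := by
  have step : ∀ u : Fin n → Bool,
      twist u x * dwt g u h = ∑ y, g y * twist h y * (g (bxor y u) * twist u x) := by
    intro u
    unfold dwt
    rw [mul_sum]
    exact sum_congr rfl fun y _ => by ring
  rw [sum_congr rfl fun u _ => step u, sum_comm, mul_sum]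
  refine sum_congr rfl fun y _ => ?_
  rw [← mul_sum, sum_shift_twist g y x]
  ring

/-- `∑_u T_f(h,u) T_g(u,h) = ∑_x f(x) f(x⊕h) W_g(x) ∑_y g(y) (-1)^{y·x} (-1)^{h·y}`. [folklore] -/
theorem sum_dwt_mul_dwt_row (f g : (Fin n → Bool) → ℝ) (h : Fin n → Bool) :
    ∑ u, dwt f h u * dwt g u h =
      ∑ x, f x * f (bxor x h) * (W g x * ∑ y, g y * twist y x * twist h y) := by
  have step : ∀ u : Fin n → Bool,
      dwt f h u * dwt g u h = ∑ x, f x * f (bxor x h) * (twist u x * dwt g u h) := by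
    intro u
    rw [dwt, sum_mul]
    exact sum_congr rfl fun x _ => by ring
  rw [sum_congr rfl fun u _ => step u, sum_comm]
  refine sum_congr rfl fun x _ => ?_
  rw [← mul_sum, sum_twist_mul_dwt]

/-- **The dequantization identity.** For ALL real `f g : {0,1}ⁿ → ℝ`,
`∑_{h,u} T_f(h,u) · T_g(u,h) = S(f,g)²`: the square of the 2-fold forrelation sum is the
(transposed) inner product of the two derivative Walsh tables. For `f = (-1)^a`, `g = (-1)^b` with
`a, b` CUBIC every table entry is an exact quadratic Gauss sum, which is what makes `Φ²` classically
estimable by length-squared sampling (module docstring). [folklore] -/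
theorem sum_dwt_mul_dwt (f g : (Fin n → Bool) → ℝ) :
    ∑ h, ∑ u, dwt f h u * dwt g u h = fsum f g ^ 2 := by
  simp_rw [sum_dwt_mul_dwt_row]
  rw [sum_comm]
  have hx : ∀ x : Fin n → Bool,
      ∑ h, f x * f (bxor x h) * (W g x * ∑ y, g y * twist y x * twist h y) =
        f x * W g x * ∑ y, g y * W f y := by
    intro x
    have e1 : ∀ h : Fin n → Bool, f x * f (bxor x h) * (W g x * ∑ y, g y * twist y x * twist h y) =
        ∑ y, f x * W g x * (g y * twist y x) * (f (bxor x h) * twist h y) := by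
      intro h
      rw [mul_sum, mul_sum]
      exact sum_congr rfl fun y _ => by ring
    rw [sum_congr rfl fun h _ => e1 h, sum_comm, mul_sum]
    refine sum_congr rfl fun y _ => ?_
    rw [← mul_sum, sum_shift_twist f x y]
    have := twist_mul_self x y
    rw [twist_comm y x]
    linear_combination (f x * W g x * g y * W f y) * this
  rw [sum_congr rfl fun x _ => hx x, ← fsum_eq_sum_mul_W', ← sum_mul, ← fsum_eq_sum_mul_W, sq]

/-- The identity for the tree's `forrelation` of Boolean data:
`2^{3n} · Φ(f,g)² = ∑_{h,u} T_f(h,u) T_g(u,h)` with `f, g` read through `signOf`.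
[cite: AaronsonAmbainis2018, §1.1.1] -/
theorem two_pow_mul_forrelation_sq (f g : (Fin n → Bool) → Bool) :
    (2 : ℝ) ^ (3 * n) * forrelation f g ^ 2 =
      ∑ h, ∑ u, dwt (fun x => signOf (f x)) h u * dwt (fun y => signOf (g y)) u h := by
  rw [sum_dwt_mul_dwt, ← phi_signOf, phi_eq_fsum, mul_pow, inv_pow, Real.sq_sqrt (by positivity)]
  field_simp

/-! ### Row mass (Parseval per derivative) and the transposition criterion -/

/-- **Row mass**: `∑_u T_f(h,u)² = 2ⁿ ∑_x (f(x) f(x⊕h))²` (Parseval for the function `x ↦ f(x)f(x⊕h)`).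
[cite: ODonnell2014, §1.4] -/
theorem sum_dwt_sq (f : (Fin n → Bool) → ℝ) (h : Fin n → Bool) :
    ∑ u, dwt f h u ^ 2 = (2 : ℝ) ^ n * ∑ x, (f x * f (bxor x h)) ^ 2 := by
  set F : (Fin n → Bool) → ℝ := fun x => f x * f (bxor x h) with hF
  have hd : ∀ u, dwt f h u = ∑ x, F x * twist u x := fun u => rfl
  have e1 : ∀ u : Fin n → Bool, dwt f h u ^ 2 = ∑ x, ∑ x', F x * F x' * twist u (bxor x x') := by
    intro u
    rw [hd, sq, sum_mul_sum]
    refine sum_congr rfl fun x _ => sum_congr rfl fun x' _ => ?_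
    rw [twist_bxor_right]
    ring
  rw [sum_congr rfl fun u _ => e1 u, sum_comm]
  have e2 : ∀ x : Fin n → Bool,
      ∑ u, ∑ x', F x * F x' * twist u (bxor x x') = (2 : ℝ) ^ n * F x ^ 2 := by
    intro x
    rw [sum_comm]
    have e3 : ∀ x' : Fin n → Bool, ∑ u, F x * F x' * twist u (bxor x x') =
        F x * F x' * (if bxor x x' = zeroVec then (2 : ℝ) ^ n else 0) := by
      intro x'
      rw [← sum_twist_left, mul_sum]
    rw [sum_congr rfl fun x' _ => e3 x']
    simp_rw [bxor_eq_zeroVec_iff, mul_ite, mul_zero]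
    rw [Finset.sum_ite_eq univ x, if_pos (mem_univ _)]
    ring
  rw [sum_congr rfl fun x _ => e2 x, ← mul_sum]

/-- Row mass for `±1`-valued `f`: `∑_u T_f(h,u)² = 4ⁿ` for EVERY `h` — the sampling distribution
`(h uniform, u ∝ T_f(h,u)²)` of the estimator is `T_f(h,u)²/8ⁿ` exactly. [cite: ODonnell2014, §1.4] -/
theorem sum_dwt_sq_of_sq (f : (Fin n → Bool) → ℝ) (hf : ∀ x, f x ^ 2 = 1) (h : Fin n → Bool) :
    ∑ u, dwt f h u ^ 2 = (4 : ℝ) ^ n := by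
  rw [sum_dwt_sq]
  simp_rw [mul_pow, hf, mul_one, sum_const, card_univ, Fintype.card_fun, Fintype.card_bool,
    Fintype.card_fin, nsmul_eq_mul, mul_one]
  push_cast
  rw [← mul_pow]
  norm_num

/-- Total mass `‖T_f‖² = ∑_{h,u} T_f(h,u)² = 8ⁿ` for `±1`-valued `f`. [cite: ODonnell2014, §1.4] -/
theorem sum_sum_dwt_sq_of_sq (f : (Fin n → Bool) → ℝ) (hf : ∀ x, f x ^ 2 = 1) :
    ∑ h, ∑ u, dwt f h u ^ 2 = (8 : ℝ) ^ n := by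
  simp_rw [sum_dwt_sq_of_sq f hf, sum_const, card_univ, Fintype.card_fun, Fintype.card_bool,
    Fintype.card_fin, nsmul_eq_mul]
  push_cast
  rw [← mul_pow]
  norm_num

/-- **Robust transposition formula**: for `±1`-valued `f, g`,
`∑_{h,u} (T_f(h,u) - T_g(u,h))² = 2·8ⁿ - 2·S(f,g)²` (`= 2·8ⁿ(1 - Φ²)`). [folklore] -/
theorem sum_sq_sub_eq (f g : (Fin n → Bool) → ℝ) (hf : ∀ x, f x ^ 2 = 1) (hg : ∀ x, g x ^ 2 = 1) :
    ∑ h, ∑ u, (dwt f h u - dwt g u h) ^ 2 = 2 * (8 : ℝ) ^ n - 2 * fsum f g ^ 2 := by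
  have e : ∀ h u : Fin n → Bool, (dwt f h u - dwt g u h) ^ 2 =
      dwt f h u ^ 2 + dwt g u h ^ 2 - 2 * (dwt f h u * dwt g u h) := fun h u => by ring
  simp_rw [e, sum_sub_distrib, sum_add_distrib, ← mul_sum]
  rw [sum_sum_dwt_sq_of_sq f hf, sum_dwt_mul_dwt,
    sum_comm (f := fun h u => dwt g u h ^ 2), sum_sum_dwt_sq_of_sq g hg]
  ring

/-- **Completeness of the one-sided test**: if `S(f,g)² = 8ⁿ` (i.e. `Φ = ±1`: `g` bent with dual `±f`)
then the derivative Walsh tables are transposes of each other, `T_g(u,h) = T_f(h,u)` for ALL `h, u` —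
so every sample of the estimator matches exactly on a yes-instance of the exact slice. (Carlet's
identity `W_{D_h a}(u) = W_{D_u ã}(h)` for a bent `a` with dual `ã`, here with its converse.) [folklore] -/
theorem dwt_transpose_of_fsum_sq (f g : (Fin n → Bool) → ℝ) (hf : ∀ x, f x ^ 2 = 1)
    (hg : ∀ x, g x ^ 2 = 1) (hS : fsum f g ^ 2 = (8 : ℝ) ^ n) (h u : Fin n → Bool) :
    dwt g u h = dwt f h u := by
  have htot : ∑ h, ∑ u, (dwt f h u - dwt g u h) ^ 2 = 0 := by
    rw [sum_sq_sub_eq f g hf hg, hS]; ring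
  have hrow : ∀ h ∈ (univ : Finset (Fin n → Bool)), ∑ u, (dwt f h u - dwt g u h) ^ 2 = 0 :=
    (sum_eq_zero_iff_of_nonneg fun h _ => sum_nonneg fun u _ => sq_nonneg _).1 htot
  have hent := (sum_eq_zero_iff_of_nonneg fun u _ => sq_nonneg _).1 (hrow h (mem_univ _)) u
    (mem_univ _)
  have : dwt f h u - dwt g u h = 0 := pow_eq_zero_iff (n := 2) (by norm_num) |>.1 hent
  linarith

/-- The same over the tree's `forrelation`: `Φ(f,g)² = 1 ⇒ T_g = T_fᵀ` entrywise.
[cite: AaronsonAmbainis2018, §1.1.1] -/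
theorem dwt_transpose_of_forrelation_sq_eq_one (f g : (Fin n → Bool) → Bool)
    (hΦ : forrelation f g ^ 2 = 1) (h u : Fin n → Bool) :
    dwt (fun y => signOf (g y)) u h = dwt (fun x => signOf (f x)) h u := by
  refine dwt_transpose_of_fsum_sq _ _ (fun x => signOf_sq (f x)) (fun y => signOf_sq (g y)) ?_ h u
  have key := two_pow_mul_forrelation_sq f g
  rw [hΦ, mul_one, sum_dwt_mul_dwt] at key
  rw [← key, pow_mul]
  norm_num

/-! ### White-box instances with `Φ = 1` -/

/-- On every two-circuit instance with `I.value = 1` (`I.k = 2`) the derivative Walsh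
tables of the two computed functions are transposes of each other — the completeness half of the
one-sided classical test (every sampled entry matches). [cite: AaronsonAmbainis2018, §1.1.1] -/
theorem tables_transposed_of_value_eq_one {I : KForrelationInstance} (hk : I.k = 2)
    (hv : I.value = 1) (h u : Fin I.n → Bool) :
    dwt (fun y => signOf ((I.C (Fin.cast hk.symm 1)).eval y)) u h =
      dwt (fun x => signOf ((I.C (Fin.cast hk.symm 0)).eval x)) h u := by
  refine dwt_transpose_of_forrelation_sq_eq_one _ _ ?_ h u
  rw [← KForrelationInstance.value_eq_forrelation hk, hv, one_pow]

/-! ### Blindness to the sign of `Φ` -/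

/-- Negating `f` does not change its derivative Walsh table: `T_{-f} = T_f`. So every statistic of
the dequantization (all table entries of both functions) is BLIND to `g ↦ -g`, i.e. to
`b ↦ b + 1`, which flips the sign of `Φ`. [folklore] -/
theorem dwt_neg (f : (Fin n → Bool) → ℝ) (h u : Fin n → Bool) :
    dwt (fun x => -f x) h u = dwt f h u := by
  unfold dwt
  exact sum_congr rfl fun x _ => by ring

/-- Complementing the Boolean data negates the sign reading: `signOf (!b) = - signOf b`.
[cite: AaronsonAmbainis2018, §1.1.1] -/
theorem signOf_not (b : Bool) : signOf (!b) = -signOf b := by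
  cases b <;> simp [signOf]

/-- Complementing `g` flips the forrelation: `Φ(f, ¬g) = -Φ(f,g)`. [cite: AaronsonAmbainis2018, §1.1.1] -/
theorem forrelation_not_right (f g : (Fin n → Bool) → Bool) :
    forrelation f (fun y => !g y) = -forrelation f g := by
  unfold forrelation
  simp_rw [signOf_not, mul_neg, sum_neg_distrib, mul_neg]

/-- … while the derivative Walsh table of `¬g` equals that of `g`: the pairs `(f,g)` (`Φ = 1`) and
`(f,¬g)` (`Φ = -1`) have identical tables. [folklore] -/
theorem dwt_signOf_not (g : (Fin n → Bool) → Bool) (h u : Fin n → Bool) :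
    dwt (fun y => signOf (!g y)) h u = dwt (fun y => signOf (g y)) h u := by
  simp_rw [signOf_not]
  exact dwt_neg _ h u

end DerivativeWalsh

end Literature.Computability.QuantumComplexity

end
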